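import Summits.CriticalPhenomena.SAWScalingLimit.Theses.SAWResidueField

/-!
# `SquareTransfer` (item stmt-CriticalPhenomena-14521, route `SAWResidueField`) — the δℤ² transfer glue

`SquareTransfer := HexEndpointApproxExists (written out) → (DCS 2012 Conjecture 1 on the hexagonal lattice,
written out; "(A)") → LatticeUniversality → SAWScalingLimit` — the two-ε argument, self-contained (only the
route file is imported). Same argument as the crux sandwich
`Sandwich.hexTransfer_of_latticeUniversality` (`Theorems/SAWPhaseRetrievalHexTransferOfLatticeUniversality.lean`,
p106915: `LatticeUniversality → HexTransfer`), here with the hexagonal endpoint approximation taken from the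
first antecedent instead of the landed existence theorem (item 9864), so that nothing but the statement's
own hypotheses is used. A refuter's candidate (`Batch45Proof.lean`, refute-pool-g48-0, attached to the item)
proves the same statement in 10 tactic lines.
-/

noncomputable section

namespace Summit.CriticalPhenomena.SAWScalingLimit.Cruxes.HexTransfer.Sandwich

open MeasureTheory Filter Topology
open Literature.Probability.RandomPlanarGeometry Literature.Probability.RandomPlanarGeometry.SAW
open Summit.CriticalPhenomena.SAWScalingLimit.Theses

/-- **Item stmt-CriticalPhenomena-14521 (`SquareTransfer`)**: given a `δℤ²` endpoint approximation `(a, b)` of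
a Dobrushin domain `D`, take a hexagonal one `(a', b')` (first antecedent); DCS Conjecture 1 (second
antecedent) gives a chordal SLE(8/3) random curve `Γ` of `D` with `∫ f dP^{Hex}_δ → E f(Γ)` for every bounded
continuous `f`; lattice universality (third antecedent) gives `∫ f dP^{ℤ²}_δ - ∫ f dP^{Hex}_δ → 0`; adding,
`∫ f dP^{ℤ²}_δ → E f(Γ)`, and measurability of `γ ↦ γ.curve` is automatic (discrete σ-algebra), which is
`ConvergesInLawToSLE (8/3)` for the `δℤ²` law with the same `Γ`. [folklore] -/
theorem squareTransfer : SAWResidueField.SquareTransfer := by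
  intro hE hA hU D a b hab
  obtain ⟨a', b', hab'⟩ := hE D a b hab
  obtain ⟨Γ, hΓ, -, hT⟩ := hA D a' b' hab'
  refine ⟨Γ, hΓ, Eventually.of_forall fun δ => aemeasurable_curve D.carrier δ (a δ) (b δ), fun f => ?_⟩
  have h := (hU D a b a' b' hab hab' f).add (hT f)
  rw [zero_add] at h
  exact h.congr fun δ => sub_add_cancel _ _

end Summit.CriticalPhenomena.SAWScalingLimit.Cruxes.HexTransfer.Sandwich

end
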